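import Literature.NumberTheory.QuadraticForms.SymplecticLatticePairAdaptedBasis
import HarnessLib

/-!
# Adapted symplectic bases for a unimodular lattice and a MODULAR lattice (the lattice form of the Cartan
# decomposition of the symplectic SIMILITUDE group `GSp`)

Topic `NumberTheory/QuadraticForms`; namespace `Literature.NumberTheory.QuadraticForms.SymplecticLatticePair` (lane
`lit-hodgefound`, Track 2 foundations; seat `lit-hodgefound-p11`, generation 34, row g34-#4, file 8).  THEOREMS ONLY (D-0026).
Sequel of `SymplecticLatticePairSplitting` / `…AdaptedBasis`: there both lattices were unimodular for the same alternating
form `B`; here `L` is unimodular for `B` and `M` is unimodular for the rescaled form `μ⁻¹ B` (`μ ∈ Kˣ` arbitrary), i.e. `M` is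
`μ`-MODULAR for `B` (`M^# = μ⁻¹ M`) — exactly the lattices `M = g L` for `g` a symplectic similitude with multiplier `μ`.

## The print

[Shimura1963AnalyticFamilies] §1 (lattices `L` in an alternating space with `B(L, L) ⊆ 𝔞`, «maximal» lattices and their
normal form relative to a second lattice: Prop. 1.6–1.7 / the elementary divisors `{ϖ^{r_i}, ϖ^{e - r_i}}` of a polarised
lattice pair); [AndrianovZhuravlev1995] Ch. 3 §3, Lemma 3.6 (the symplectic divisor matrix
`sd(M) = diag(d₁, …, d_n; e₁, …, e_n)`, `dᵢ eᵢ = r(M)` the multiplier — the `ℤ`-form of this statement for `GSp_n`);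
[Kottwitz1992] §7, Lemma 7.4 (Case C: the group of symplectic similitudes).  Proof as in file 1 ([Jacobowitz1962] §§4–5 /
[Omeara1963] §82F): a vector of `M` of extremal level, a hyperbolic partner in `L`, the self-duality of `M` for `μ⁻¹ B`
puts `μ ϖ^{a} y` in `M`, split both lattices by the common orthogonal complement, induct.

## What is formalised (`K` a field with `Valued K ℤᵐ⁰`, `ϖ` a uniformiser, `B` alternating on a finite-dimensional `V`)

* §1 rescaled forms: `smul_apply₂`, `isAlt_smul`, `orth_smul_form`, `orthInt_smul_form`.
* §2 `exists_int_level` — for `L` unimodular and `M ≠ 0` a lattice in the same `W`: the least `a : ℤ` with `ϖ^{a} M ⊆ L`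
  and a vector `m ∈ M` with `ϖ^{a} m` primitive in `L`.
* §3 `exists_adapted_hyperbolicPair_of_modular` — `a : ℤ` and a hyperbolic pair `x, y ∈ L` (for `B`) with `ϖ^{-a} x ∈ M`
  and `μ ϖ^{a} y ∈ M`.
* §4 **`exists_adapted_symplectic_basis_of_modular`** — `L = span_𝒪 {xᵢ, yᵢ}`, `M = span_𝒪 {ϖ^{-aᵢ} xᵢ, μ ϖ^{aᵢ} yᵢ}`
  with `(xᵢ, yᵢ)` pairwise orthogonal hyperbolic pairs and `aᵢ : ℤ`: the elementary divisors of the pair `(L, M)` are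
  `{ϖ^{-aᵢ}, μ ϖ^{aᵢ}}` — the lattice form of `GSp(K) = Sp(𝒪) · diag(μ ϖ^{a}; ϖ^{-a}) · Sp(𝒪)`.

## References
* [Shimura1963AnalyticFamilies] G. Shimura, Ann. of Math. 78 (1963), §1, Prop. 1.6–1.7.
* [AndrianovZhuravlev1995] A. N. Andrianov, V. G. Zhuravlev, *Modular Forms and Hecke Operators* (1995), Ch. 3 §3, Lemma 3.6.
* [Kottwitz1992] R. E. Kottwitz, J. AMS 5 (1992), §7, Lemma 7.4.
* [Jacobowitz1962] R. Jacobowitz, Amer. J. Math. 84 (1962), §§4–5.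
* [Omeara1963] O. T. O'Meara, *Introduction to Quadratic Forms* (1963), §81D, §82F.
-/

noncomputable section

open scoped Valued WithZero
open LinearMap (BilinForm)

namespace Literature.NumberTheory.QuadraticForms.SymplecticLatticePair

open Literature.NumberTheory.Automorphic.HermitianLattice

variable {K : Type*} [Field K] [Valued K ℤᵐ⁰] {ϖ : K} {V : Type*} [AddCommGroup V] [Module K V]
  [FiniteDimensional K V] {B : BilinForm K V}

/-! ## §1 Rescaling the form -/

section Rescale

omit [Valued K ℤᵐ⁰] [FiniteDimensional K V]

/-- `(c • B) x y = c * B x y`. [cite: Omeara1963, §82F] -/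
theorem smul_apply₂ (c : K) (x y : V) : (c • B) x y = c * B x y := by
  rw [LinearMap.smul_apply, LinearMap.smul_apply, smul_eq_mul]

/-- A rescaled alternating form is alternating. [cite: Omeara1963, §82F] -/
theorem isAlt_smul (hBa : B.IsAlt) (c : K) : (c • B).IsAlt := fun x => by
  rw [smul_apply₂, hBa x, mul_zero]

/-- Rescaling the form does not change orthogonal complements of planes. [cite: Omeara1963, §42D] -/
theorem orth_smul_form {c : K} (hc : c ≠ 0) (x y : V) : orth (c • B) x y = orth B x y := by
  ext z
  rw [mem_orth, mem_orth, smul_apply₂, smul_apply₂, mul_eq_zero, mul_eq_zero, or_iff_right hc, or_iff_right hc]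

/-- Rescaling the form does not change the integral orthogonal complements. [cite: Omeara1963, §82F] -/
theorem orthInt_smul_form [Valued K ℤᵐ⁰] {c : K} (hc : c ≠ 0) (x y : V) : orthInt (c • B) x y = orthInt B x y := by
  rw [orthInt, orthInt, orth_smul_form hc]

end Rescale

/-! ## §2 The (integer) level of a lattice relative to a unimodular lattice -/

omit [FiniteDimensional K V] in
/-- A uniform `ϖ`-power bringing a finitely generated `M ⊆ W` into the unimodular lattice `L` of `W`.
[cite: Omeara1963, §81D] -/
theorem exists_nat_level (hϖ : Valued.v ϖ = WithZero.exp (-1 : ℤ)) {W : Submodule K V} {L M : Submodule 𝒪[K] V}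
    (hL : IsUnimodularLattice B W L) (hMfg : M.FG) (hMW : ∀ m ∈ M, m ∈ W) :
    ∃ t : ℕ, ∀ m ∈ M, (ϖ ^ t) • m ∈ L := by
  classical
  obtain ⟨S, hSfin, hSspan⟩ := Submodule.fg_def.1 hMfg
  have hSW : ∀ s ∈ S, s ∈ W := fun s hs => hMW s (hSspan ▸ Submodule.subset_span hs)
  choose! k hk using fun s (hs : s ∈ S) => hL.exists_pow_smul_mem' hϖ (hSW s hs)
  have hϖ1 : Valued.v ϖ ≤ 1 := by rw [hϖ]; exact le_of_lt (WithZero.exp_lt_exp.2 (by norm_num))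
  refine ⟨hSfin.toFinset.sup k, fun m hm => ?_⟩
  rw [← hSspan] at hm
  induction hm using Submodule.span_induction with
  | mem s hs =>
    have hle : k s ≤ hSfin.toFinset.sup k := Finset.le_sup (hSfin.mem_toFinset.2 hs)
    obtain ⟨d, hd⟩ := Nat.exists_eq_add_of_le hle
    rw [hd, pow_add, mul_comm, mul_smul]
    exact smul_mem_of_v_le L (by rw [map_pow]; exact pow_le_one' hϖ1 _) (hk s hs)
  | zero => rw [smul_zero]; exact L.zero_mem
  | add u w _ _ hu hw => rw [smul_add]; exact L.add_mem hu hw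
  | smul c w _ hw => rw [smul_comm]; exact L.smul_mem c hw

omit [FiniteDimensional K V] in
/-- **The integer level of `M` relative to `L`.**  For `L` unimodular in `W` and `M ≠ 0` finitely generated inside `W`
there is `a : ℤ` with `ϖ^{a} M ⊆ L` and a vector `m ∈ M` with `ϖ^{a} m` PRIMITIVE in `L` (`ϖ⁻¹ ϖ^{a} m ∉ L`): `a` is the
least integer with `ϖ^{a} M ⊆ L` (it exists because `L` is bounded). [cite: Omeara1963, §81D] -/
theorem exists_int_level (hϖ : Valued.v ϖ = WithZero.exp (-1 : ℤ)) {W : Submodule K V} {L M : Submodule 𝒪[K] V}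
    (hL : IsUnimodularLattice B W L) (hMfg : M.FG) (hMW : ∀ m ∈ M, m ∈ W) (hM0 : M ≠ ⊥) :
    ∃ a : ℤ, (∀ m ∈ M, (ϖ ^ a) • m ∈ L) ∧ ∃ m ∈ M, ϖ⁻¹ • ((ϖ ^ a) • m) ∉ L := by
  have hϖ0 : ϖ ≠ 0 := fun h0 => by
    rw [h0, map_zero] at hϖ
    exact WithZero.coe_ne_zero hϖ.symm
  have hϖ1 : Valued.v ϖ ≤ 1 := by rw [hϖ]; exact le_of_lt (WithZero.exp_lt_exp.2 (by norm_num))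
  -- upper witness: a natural level
  obtain ⟨t, ht⟩ := exists_nat_level hϖ hL hMfg hMW
  -- lower bound: a non-zero vector of `M` leaves `L` under negative powers
  obtain ⟨m₀, hm₀M, hm₀⟩ := (Submodule.ne_bot_iff M).1 hM0
  obtain ⟨k, hk⟩ := exists_pow_inv_smul_notMem hϖ hL.fg hm₀
  obtain ⟨a, ha, hmin⟩ := Int.exists_least_of_bdd (P := fun a : ℤ => ∀ m ∈ M, (ϖ ^ a) • m ∈ L)
    ⟨-(k : ℤ), fun a haP => by
      by_contra hlt
      push Not at hlt
      apply hk
      -- `(ϖ^k)⁻¹ m₀ = ϖ^{-k-a} • ϖ^{a} m₀ ∈ L`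
      obtain ⟨d, hd⟩ := Int.le.dest hlt.le
      have h1 : (ϖ ^ k)⁻¹ • m₀ = (ϖ ^ d) • ((ϖ ^ a) • m₀) := by
        rw [smul_smul, ← zpow_natCast ϖ d, ← zpow_add₀ hϖ0, add_comm, hd, zpow_neg, zpow_natCast]
      rw [h1]
      exact smul_mem_of_v_le L (by rw [map_pow]; exact pow_le_one' hϖ1 _) (haP m₀ hm₀M)⟩
    ⟨(t : ℤ), fun m hm => by rw [zpow_natCast]; exact ht m hm⟩
  refine ⟨a, ha, ?_⟩
  by_contra H
  push Not at H
  have hP : ∀ m ∈ M, (ϖ ^ (a - 1)) • m ∈ L := fun m hm => by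
    rw [zpow_sub_one₀ hϖ0, mul_comm, mul_smul]
    exact H m hm
  have := hmin _ hP
  omega

/-! ## §3 The adapted hyperbolic pair for a unimodular and a `μ`-modular lattice -/

omit [FiniteDimensional K V] in
/-- **The adapted hyperbolic pair, similitude version.**  `B` alternating, `L` unimodular for `B` in `W ≠ ⊥`, `M` unimodular
for `μ⁻¹ B` in `W` (`μ ≠ 0`; i.e. `M` is `μ`-modular for `B`).  Then there are `a : ℤ` and a hyperbolic pair `x, y ∈ L` for `B`
with `ϖ^{-a} x ∈ M` and `μ ϖ^{a} y ∈ M`: `m ∈ M` of extremal level, `x = ϖ^{a} m` primitive in `L`, `y ∈ L` a partner,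
and `μ ϖ^{a} y ∈ M` by the self-duality of `M` for `μ⁻¹ B` (`μ⁻¹ B(m', μ ϖ^{a} y) = B(ϖ^{a} m', y) ∈ 𝒪`).
[cite: Jacobowitz1962, §§4–5; Omeara1963, §82F; Shimura1963AnalyticFamilies, §1] -/
theorem exists_adapted_hyperbolicPair_of_modular {W : Submodule K V} {L M : Submodule 𝒪[K] V}
    (hϖ : Valued.v ϖ = WithZero.exp (-1 : ℤ)) (hBa : B.IsAlt) {μ : K} (hμ : μ ≠ 0)
    (hL : IsUnimodularLattice B W L) (hM : IsUnimodularLattice (μ⁻¹ • B) W M) (hW : W ≠ ⊥) :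
    ∃ (a : ℤ) (x y : V), IsHyperbolicPair B x y ∧ x ∈ L ∧ y ∈ L ∧
      (ϖ ^ (-a)) • x ∈ M ∧ (μ * ϖ ^ a) • y ∈ M := by
  have hϖ0 : ϖ ≠ 0 := fun h0 => by
    rw [h0, map_zero] at hϖ
    exact WithZero.coe_ne_zero hϖ.symm
  -- `M ≠ 0` since it spans `W ≠ 0`
  have hM0 : M ≠ ⊥ := by
    intro h0
    apply hW
    rw [← hM.span_eq, h0, Submodule.bot_coe, Submodule.span_zero_singleton]
  obtain ⟨a, haM, m, hm, hprim⟩ := exists_int_level hϖ hL hM.fg (fun m hm => hM.le_span hm) hM0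
  have hx : (ϖ ^ a) • m ∈ L := haM m hm
  obtain ⟨y, hy, hxy⟩ := exists_apply_eq_one_of_not_mem_of_isAlt hϖ hBa hL hx hprim
  refine ⟨a, (ϖ ^ a) • m, y, isHyperbolicPair_of_isAlt hBa hxy, hx, hy, ?_, ?_⟩
  · rw [smul_smul, zpow_neg, inv_mul_cancel₀ (zpow_ne_zero a hϖ0), one_smul]; exact hm
  · refine hM.dual _ (W.smul_mem _ (hL.le_span hy)) fun m' hm' => ?_
    rw [smul_apply₂, LinearMap.BilinForm.smul_right, ← mul_assoc, ← mul_assoc, inv_mul_cancel₀ hμ, one_mul,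
      ← LinearMap.BilinForm.smul_left]
    exact hL.integral _ (haM m' hm') _ hy

/-! ## §4 Adapted symplectic bases for `(L, M)`, `M` modular -/

omit [Valued K ℤᵐ⁰] [FiniteDimensional K V] in
/-- The scaled family `i ↦ tᵢ • (Fin.cons x₀ x) i` is `Fin.cons (t₀ • x₀) (i ↦ tᵢ₊₁ • xᵢ)`. [cite: Omeara1963, §82F] -/
private theorem smul_cons_eq' {n : ℕ} (t : Fin (n + 1) → K) (x₀ : V) (x : Fin n → V) :
    (fun i => t i • (Fin.cons x₀ x : Fin (n + 1) → V) i) = Fin.cons (t 0 • x₀) (fun i => t i.succ • x i) := by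
  funext i
  refine Fin.cases ?_ (fun j => ?_) i
  · rw [Fin.cons_zero, Fin.cons_zero]
  · rw [Fin.cons_succ, Fin.cons_succ]

omit [Valued K ℤᵐ⁰] [FiniteDimensional K V] [AddCommGroup V] [Module K V] [Field K] in
/-- `{x₀, y₀} ∪ (S ∪ T) = (insert x₀ S) ∪ (insert y₀ T)`. [cite: Omeara1963, §82F] -/
private theorem pair_union_eq'' {α : Type*} (x₀ y₀ : α) (S T : Set α) :
    ({x₀, y₀} : Set α) ∪ (S ∪ T) = insert x₀ S ∪ insert y₀ T := by
  ext z
  simp only [Set.mem_union, Set.mem_insert_iff, Set.mem_singleton_iff]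
  tauto

/-- **Adapted symplectic bases for a unimodular and a modular lattice (elementary divisors of a symplectic similitude).**
`B` alternating on the finite-dimensional `V`, `K` discretely valued with uniformiser `ϖ`, `μ ∈ K` non-zero, `L` unimodular
for `B` and `M` unimodular for `μ⁻¹ B` (i.e. `μ`-modular for `B`) in the subspace `W`.  Then there are pairwise orthogonal
hyperbolic pairs `(xᵢ, yᵢ)` for `B` and integers `aᵢ` with `L = span_𝒪 {xᵢ, yᵢ}` and
`M = span_𝒪 {ϖ^{-aᵢ} xᵢ, μ ϖ^{aᵢ} yᵢ}`.  (For `μ = 1` this is `exists_adapted_symplectic_basis`; for `L = 𝒪^{2n}`,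
`M = g 𝒪^{2n}`, `g ∈ GSp_{2n}(K)` of multiplier `μ`, it is the Cartan decomposition of `GSp` in lattice form.)
[cite: Shimura1963AnalyticFamilies, §1 Prop. 1.6–1.7; AndrianovZhuravlev1995, Ch. 3 §3, Lemma 3.6; Kottwitz1992, §7 Lemma 7.4] -/
theorem exists_adapted_symplectic_basis_of_modular (hϖ : Valued.v ϖ = WithZero.exp (-1 : ℤ)) (hBa : B.IsAlt)
    {μ : K} (hμ : μ ≠ 0) (W : Submodule K V) (L M : Submodule 𝒪[K] V) (hL : IsUnimodularLattice B W L)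
    (hM : IsUnimodularLattice (μ⁻¹ • B) W M) :
    ∃ (n : ℕ) (x y : Fin n → V) (a : Fin n → ℤ),
      (∀ i, IsHyperbolicPair B (x i) (y i)) ∧
      (∀ i j, i ≠ j → B (x i) (x j) = 0 ∧ B (x i) (y j) = 0 ∧ B (y i) (x j) = 0 ∧ B (y i) (y j) = 0) ∧
      L = Submodule.span 𝒪[K] (Set.range x ∪ Set.range y) ∧
      M = Submodule.span 𝒪[K]
        (Set.range (fun i => (ϖ ^ (-a i)) • x i) ∪ Set.range (fun i => (μ * ϖ ^ a i) • y i)) := by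
  have hϖ0 : ϖ ≠ 0 := fun h0 => by
    rw [h0, map_zero] at hϖ
    exact WithZero.coe_ne_zero hϖ.symm
  have hμi : μ⁻¹ ≠ 0 := inv_ne_zero hμ
  have hBa' : (μ⁻¹ • B).IsAlt := isAlt_smul hBa μ⁻¹
  generalize hd : Module.finrank K W = d
  induction d using Nat.strong_induction_on generalizing W L M with
  | _ d ih =>
  by_cases hW : W = ⊥
  · subst hW
    have hL0 : L = ⊥ := eq_bot_iff.2 fun z hz => hL.le_span hz
    have hM0 : M = ⊥ := eq_bot_iff.2 fun z hz => hM.le_span hz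
    refine ⟨0, Fin.elim0, Fin.elim0, Fin.elim0, fun i => i.elim0, fun i => i.elim0, ?_, ?_⟩
    · rw [hL0, Set.range_eq_empty, Set.empty_union, Submodule.span_empty]
    · rw [hM0, Set.range_eq_empty, Set.range_eq_empty, Set.empty_union, Submodule.span_empty]
  · obtain ⟨a₀, x₀, y₀, hp, hx₀, hy₀, hx₀M, hy₀M⟩ := exists_adapted_hyperbolicPair_of_modular hϖ hBa hμ hL hM hW
    have hs0 : ϖ ^ (-a₀) ≠ 0 := zpow_ne_zero _ hϖ0
    have ht0 : μ * ϖ ^ a₀ ≠ 0 := mul_ne_zero hμ (zpow_ne_zero _ hϖ0)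
    -- the pair `(ϖ^{-a₀} x₀, μ ϖ^{a₀} y₀)` is hyperbolic for `μ⁻¹ B`
    have hp' : IsHyperbolicPair (μ⁻¹ • B) ((ϖ ^ (-a₀)) • x₀) ((μ * ϖ ^ a₀) • y₀) := by
      refine isHyperbolicPair_of_isAlt hBa' ?_
      rw [smul_apply₂, LinearMap.BilinForm.smul_left, LinearMap.BilinForm.smul_right, hp.pair, mul_one, zpow_neg,
        mul_left_comm (ϖ ^ a₀)⁻¹, ← mul_assoc, inv_mul_cancel₀ hμ, one_mul, inv_mul_cancel₀ (zpow_ne_zero _ hϖ0)]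
    -- split both lattices off the common orthogonal complement
    obtain ⟨hL', hLdec⟩ := IsUnimodularLattice.restrict_of_isAlt hBa hL hp hx₀ hy₀
    obtain ⟨hM', hMdec⟩ := IsUnimodularLattice.restrict_of_isAlt hBa' hM hp' hx₀M hy₀M
    rw [orth_smul_form hμi, orth_smul hs0 ht0, orthInt_smul_form hμi, orthInt_smul hs0 ht0] at hM'
    rw [orthInt_smul_form hμi, orthInt_smul hs0 ht0] at hMdec
    -- induction hypothesis on `W' = W ∩ ⟨x₀, y₀⟩^⊥`
    have hlt : Module.finrank K ↥(W ⊓ orth B x₀ y₀) < d :=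
      hd ▸ finrank_inf_orth_lt_of_isAlt hBa hp (hL.le_span hx₀)
    obtain ⟨n, x, y, a, hhyp, horth, hLeq, hMeq⟩ := ih _ hlt (W ⊓ orth B x₀ y₀) _ _ hL' hM' rfl
    have hmemL' : ∀ z, z ∈ Set.range x ∪ Set.range y → B x₀ z = 0 ∧ B y₀ z = 0 := fun z hz => by
      have hz' : z ∈ L ⊓ orthInt B x₀ y₀ := hLeq ▸ Submodule.subset_span hz
      exact mem_orthInt.1 hz'.2
    refine ⟨n + 1, Fin.cons x₀ x, Fin.cons y₀ y, Fin.cons a₀ a, ?_, ?_, ?_, ?_⟩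
    · intro i
      refine Fin.cases ?_ (fun j => ?_) i
      · simpa only [Fin.cons_zero] using hp
      · simpa only [Fin.cons_succ] using hhyp j
    · intro i j hij
      refine Fin.cases ?_ (fun s => ?_) i j hij
      · intro j hij
        refine Fin.cases (fun h => absurd rfl h) (fun t _ => ?_) j hij
        simp only [Fin.cons_zero, Fin.cons_succ]
        obtain ⟨h1, h2⟩ := hmemL' (x t) (Or.inl ⟨t, rfl⟩)
        obtain ⟨h3, h4⟩ := hmemL' (y t) (Or.inr ⟨t, rfl⟩)
        exact ⟨h1, h3, h2, h4⟩
      · intro j hij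
        refine Fin.cases (fun _ => ?_) (fun t hst => ?_) j hij
        · simp only [Fin.cons_zero, Fin.cons_succ]
          obtain ⟨h1, h2⟩ := hmemL' (x s) (Or.inl ⟨s, rfl⟩)
          obtain ⟨h3, h4⟩ := hmemL' (y s) (Or.inr ⟨s, rfl⟩)
          refine ⟨?_, ?_, ?_, ?_⟩
          · rw [← hBa.neg_eq, h1, neg_zero]
          · rw [← hBa.neg_eq, h2, neg_zero]
          · rw [← hBa.neg_eq, h3, neg_zero]
          · rw [← hBa.neg_eq, h4, neg_zero]
        · simp only [Fin.cons_succ]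
          exact horth s t fun h => hst (congrArg Fin.succ h)
    · rw [Fin.range_cons, Fin.range_cons, hLdec, hLeq, ← Submodule.span_union, pair_union_eq'']
    · rw [smul_cons_eq' (fun i => ϖ ^ (-(Fin.cons a₀ a : Fin (n + 1) → ℤ) i)) x₀ x,
        smul_cons_eq' (fun i => μ * ϖ ^ (Fin.cons a₀ a : Fin (n + 1) → ℤ) i) y₀ y]
      simp only [Fin.cons_zero, Fin.cons_succ]
      rw [Fin.range_cons, Fin.range_cons, hMdec, hMeq, ← Submodule.span_union, pair_union_eq'']

/-- **The case `W = ⊤`** (lattices in the whole space). [cite: Shimura1963AnalyticFamilies, §1; AndrianovZhuravlev1995, Ch. 3 §3, Lemma 3.6] -/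
theorem exists_adapted_symplectic_basis_of_modular_top (hϖ : Valued.v ϖ = WithZero.exp (-1 : ℤ)) (hBa : B.IsAlt)
    {μ : K} (hμ : μ ≠ 0) (L M : Submodule 𝒪[K] V) (hL : IsUnimodularLattice B ⊤ L)
    (hM : IsUnimodularLattice (μ⁻¹ • B) ⊤ M) :
    ∃ (n : ℕ) (x y : Fin n → V) (a : Fin n → ℤ),
      (∀ i, IsHyperbolicPair B (x i) (y i)) ∧
      (∀ i j, i ≠ j → B (x i) (x j) = 0 ∧ B (x i) (y j) = 0 ∧ B (y i) (x j) = 0 ∧ B (y i) (y j) = 0) ∧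
      L = Submodule.span 𝒪[K] (Set.range x ∪ Set.range y) ∧
      M = Submodule.span 𝒪[K]
        (Set.range (fun i => (ϖ ^ (-a i)) • x i) ∪ Set.range (fun i => (μ * ϖ ^ a i) • y i)) :=
  exists_adapted_symplectic_basis_of_modular hϖ hBa hμ ⊤ L M hL hM

end Literature.NumberTheory.QuadraticForms.SymplecticLatticePair

end
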